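import Mathlib
import HarnessLib
import Summits.HubbardSuperconductivity.HubbardSuperconductivity.Theorems.KLProgrammeKLRegimeEngineLevelsQuarticRowOfMomentumRep
import Summits.HubbardSuperconductivity.HubbardSuperconductivity.Theorems.KLProgrammeKLRegimeTorusL1ProductBump

/-!
# Route `KLProgramme` — crux K3 ENGINE (stmt-HubbardSuperconductivity-20437 `KLRegimeEngineV17F2`), ROW (X) `stub_engine_exports`, conjunct (X).1
# (binder `hX1`, E1-LEDGER §1 #3), step 2: the QUARTIC ROW of `LevelsUAt … K j` from a CANONICAL PRODUCT-BUMP representation of the `↑↓` quartic kernel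
# of `𝒱_j[K]` — the (T1) second-difference bump data DISCHARGED by (T4) `productBump_bumpData` (cell gate-hubbard-kl, seat p3 g25)

Sequel to `…EngineLevelsQuarticRowOfMomentumRep` (this seat, p737776: the quartic row from a representation with GENERIC bumps carrying (T1) data) and the
(X).1 twin of `…EngineRowBPlainLineOfProductBumps` (p737610, row (b)'s weighted lines): with the canonical product bumps
`B_{R₀,R₁}(q) = φ(q̃₁/R₀)·φ((q̃₂)₀/R₁)·φ((q̃₂)₁/R₁)` of (T4) (k3c2-p3 g16) the producer supplies ONE profile `φ ∈ C²` (`|φ| ≤ 1`, `φ = 0` off `(−1,1)`, `|φ″| ≤ κ²`,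
`κ ≥ 1`), integer radii, amplitudes `a_i`, a normalisation `κ'` and the remainder's plain line `r`; the rate form `s₀ = 4R₀/(κ·2M)`, `s₁ = 4R₁/(κ·L)`, `A = 1`,
`n₀ = κ³` is the algebra of `sum_norm_charSum_productBump_le`:

* §1 **`plainLine_klEffectiveAction_allStrings_of_productBumpRepresentation`** — any frame `K`, any `e₀ n`:
  `∀ s c' y, fixedTupleL1 … (((0, s i), c' i)) y ≤ 2·(ε³·(‖κ'‖(2M·L²)²)·√(10485760·κ³)·(2M·L²)·Σ_{i∈S}‖a_i‖ + r)`;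
* §2 **`levelsUQuarticRow_klEng_of_productBumpRepresentation`** — `∃ CA > 0`: under (T3)'s binders the product-bump representation + closure
  `2·klThinCountC·CA⁴·(2·(…)) ≤ c₂·(Klam·|U|)` ⟹ `∀ Ωe, klAnisoLegKernelNormAt … K klE0 j 4 Ωe ≤ c₂·(Klam·|U|)·2^j`.
So ONE producer object — profile + radii + amplitudes + normalisation + remainder lines of the `↑↓` quartic kernel of `𝒱_j[K]` — feeds BY NAME row (b)'s #6 `hplainE1`
(`wplainLineFamily_klEng_of_productBumpFamily`, `φ ∈ C³` there), #5 (E4) (`hE4_of_productBumpLevels`) and (X).1's quartic row (this file, `φ ∈ C²` suffices).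
Everything is proved; no definitions; the representation stays a HYPOTHESIS (E1); nothing asserts (X).1, `hX1`, any stub of 20437, K3, U₀, the window or
superconductivity.  References: BGM 2006 §2.3 (2.17), (2.41a), §2.8 (2.76)–(2.81) footnote 1, (2.96)–(2.98), §3 (3.65) [cite: BenfattoGiulianiMastropietro2006];
Katznelson, *Harmonic Analysis*, Ch. I §6.3.
-/

noncomputable section

namespace Summit.HubbardSuperconductivity.HubbardSuperconductivity.Theorems.EngineV8

set_option linter.dupNamespace false -- summit = problem name (single-conjunct summit), D-0017

open Classical
open Real Finset Complex Literature.MathematicalPhysics.QuantumLattice Literature.Probability.LatticeModels GrassmannAlgebra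
open Literature.MathematicalPhysics.QuantumLattice.FermiRG
open Summit.HubbardSuperconductivity.HubbardSuperconductivity.Theorems.KLProgrammeLegKernels
open Summit.HubbardSuperconductivity.HubbardSuperconductivity.Theorems.KLRegimeSplit
open Summit.HubbardSuperconductivity.HubbardSuperconductivity.Theorems.DispersionFlow
open Summit.HubbardSuperconductivity.HubbardSuperconductivity.Theorems.KLRegimeWick
open Summit.HubbardSuperconductivity.HubbardSuperconductivity.Theorems.TorusFourierL2

variable {L M : ℕ} [NeZero L] [NeZero M]

/-! ## §1 Every label string of the plain pinned line from a canonical PRODUCT-BUMP representation -/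

/-- **THE PLAIN FOUR-LEG PINNED LINE OF `𝒱ₙ[K]` AT EVERY SPIN/CHARGE STRING FROM A CANONICAL PRODUCT-BUMP REPRESENTATION** of its `↑↓` quartic momentum kernel:
bumps `q ↦ φ(q̃₁/R₀ⁱ)·φ((q̃₂)₀/R₁ⁱ)·φ((q̃₂)₁/R₁ⁱ)` with ONE profile `φ ∈ C²` (`|φ| ≤ 1`, `φ = 0` off `(−1,1)`, `|φ″| ≤ κ²`, `κ ≥ 1`) and integer radii `R₀ⁱ, R₁ⁱ ≥ 1`
(`4R₀ⁱ ≤ 2M`, `2R₀ⁱ + 4 ≤ 2M`, `4R₁ⁱ ≤ L`, `2R₁ⁱ + 4 ≤ L`); the (T1) second-difference bump data are DISCHARGED by (T4) `productBump_bumpData` in the rate form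
`s₀ = 4R₀/(κ·2M)`, `s₁ = 4R₁/(κ·L)`, `A = 1`, `n₀ = κ³`:
`∀ s c' y, fixedTupleL1 … (((0, s i), c' i)) y ≤ 2·(ε³·(‖κ'‖(2M·L²)²)·√(10485760·κ³)·(2M·L²)·Σ_{i∈S}‖a_i‖ + r)`.
[cite: BenfattoGiulianiMastropietro2006, §2.1 (1)-(3), §2.3 (2.17), §2.8 (2.81) footnote 1, §3 (3.65)] -/
theorem plainLine_klEffectiveAction_allStrings_of_productBumpRepresentation {ι : Type*} {β : ℝ} (hβ : 0 < β) (U μ : ℝ) (K : TrigPolyC4v) (e₀ : ℝ)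
    (n : ℕ) (φ : ℝ → ℝ) (hφ : ContDiff ℝ 2 φ) {κ : ℝ} (hκ1 : 1 ≤ κ) (hK2 : ∀ t, |iteratedDeriv 2 φ t| ≤ κ ^ 2) (hφ1 : ∀ t, |φ t| ≤ 1)
    (hφ0 : ∀ t, 1 ≤ |t| → φ t = 0)
    (S : Finset ι) (a : ι → ℂ) (κ' : ℂ) (R₀ R₁ : ι → ℕ) (hR₀ : ∀ i ∈ S, 0 < R₀ i) (hR₁ : ∀ i ∈ S, 0 < R₁ i)
    (hP : ∀ i ∈ S, 4 * R₀ i ≤ 2 * M) (hL : ∀ i ∈ S, 4 * R₁ i ≤ L) (hP' : ∀ i ∈ S, 2 * R₀ i + 4 ≤ 2 * M) (hL' : ∀ i ∈ S, 2 * R₁ i + 4 ≤ L)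
    (ρ : (Fin 4 → FreqMomentum L M) → ℂ)
    (hker : ∀ k : Fin 4 → FreqMomentum L M,
      kernel ℂ (klEffectiveAction L M β U μ K e₀ n) 4 (fun i => ((k i, (![0, 1, 0, 1] : Fin 4 → Fin 2) i), (![0, 0, 1, 1] : Fin 4 → Fin 2) i)) =
        ∑ i ∈ S, a i * (κ' * (if ((fun _ : Fin 1 => ((((k 0).1 : ℕ) : ZMod (2 * M)))), (k 0).2) + ((fun _ : Fin 1 => ((((k 1).1 : ℕ) : ZMod (2 * M)))), (k 1).2) = (((fun _ : Fin 1 => ((((k 2).1 : ℕ) : ZMod (2 * M)))), (k 2).2) : TorusSite 1 (2 * M) × TorusSite 2 L) + ((fun _ : Fin 1 => ((((k 3).1 : ℕ) : ZMod (2 * M)))), (k 3).2) then (fun Q => (fun q : TorusSite 1 (2 * M) × TorusSite 2 L => (((φ (((q.1 0).valMinAbs : ℝ) / R₀ i) * (φ (((q.2 0).valMinAbs : ℝ) / R₁ i) * φ (((q.2 1).valMinAbs : ℝ) / R₁ i)) : ℝ) : ℂ))) (-Q)) (((fun _ : Fin 1 => ((((k 0).1 : ℕ) : ZMod (2 * M)))),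 (k 0).2) + ((fun _ : Fin 1 => ((((k 1).1 : ℕ) : ZMod (2 * M)))), (k 1).2)) else 0)) + ρ k)
    {r : ℝ}
    (hr : ∀ y : SpaceTimeIdx L M, fixedTupleL1 L M β 3
      (fun (Ω : Fin 4 → SectorLeg 1) (x : Fin 4 → SpaceTimeIdx L M) =>
        ∑ k : Fin 4 → FreqMomentum L M, (∏ i, trivialMultiplier L M (Ω i).1.1 (k i) * hubbardPlaneWave L M β (Ω i).2 (k i) (x i)) * ρ k)
      (fun i : Fin 4 => ((((0 : Fin 1), (![0, 1, 0, 1] : Fin 4 → Fin 2) i) : Fin 1 × Fin 2), (![0, 0, 1, 1] : Fin 4 → Fin 2) i)) y ≤ r)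
    (s c' : Fin 4 → Fin 2) (y : SpaceTimeIdx L M) :
    fixedTupleL1 L M β 3 (sectorisedKernel L M β (trivialMultiplier L M) (klEffectiveAction L M β U μ K e₀ n) 4)
        (fun i => ((((0 : Fin 1), s i) : Fin 1 × Fin 2), c' i)) y ≤
      2 * (imagTimeWeight β M ^ 3 * ((‖κ'‖ * ((((2 * M : ℕ) : ℝ) * (L : ℝ) ^ 2) ^ 2)) * (Real.sqrt (10485760 * κ ^ 3) * (((2 * M : ℕ) : ℝ) * (L : ℝ) ^ 2))) *
        ∑ i ∈ S, ‖a i‖ + r) := by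
  have hκ0 : 0 < κ := lt_of_lt_of_le one_pos hκ1
  have hM0 : (0 : ℝ) < ((2 * M : ℕ) : ℝ) := by have := NeZero.ne M; positivity
  have hL0 : (0 : ℝ) < (L : ℝ) := Nat.cast_pos.2 (Nat.pos_of_ne_zero (NeZero.ne L))
  set G : ι → TorusSite 1 (2 * M) × TorusSite 2 L → ℂ := (fun i q =>
    (((φ (((q.1 0).valMinAbs : ℝ) / R₀ i) * (φ (((q.2 0).valMinAbs : ℝ) / R₁ i) * φ (((q.2 1).valMinAbs : ℝ) / R₁ i)) : ℝ) : ℂ))) with hGdef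
  set s₀ : ι → ℝ := fun i => 4 * R₀ i / (κ * (2 * M : ℕ)) with hs₀
  set s₁ : ι → ℝ := fun i => 4 * R₁ i / (κ * L) with hs₁
  have hs₀pos : ∀ i ∈ S, 0 < s₀ i := fun i hi => by
    have := hR₀ i hi; simp only [hs₀]; positivity
  have hs₁pos : ∀ i ∈ S, 0 < s₁ i := fun i hi => by
    have := hR₁ i hi; simp only [hs₁]; positivity
  have hs₀1 : ∀ i ∈ S, s₀ i ≤ 1 := fun i hi => by
    simp only [hs₀]
    rw [div_le_one (by positivity)]
    have : (4 * R₀ i : ℝ) ≤ ((2 * M : ℕ) : ℝ) := by exact_mod_cast hP i hi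
    nlinarith
  have hs₁1 : ∀ i ∈ S, s₁ i ≤ 1 := fun i hi => by
    simp only [hs₁]
    rw [div_le_one (by positivity)]
    have : (4 * R₁ i : ℝ) ≤ L := by exact_mod_cast hL i hi
    nlinarith
  have hκne : κ ≠ 0 := hκ0.ne'
  have hs₀P : ∀ i ∈ S, s₀ i * ((2 * M : ℕ) : ℝ) = 4 * R₀ i / κ := fun i hi => by simp only [hs₀]; field_simp
  have hs₁L : ∀ i ∈ S, s₁ i * L = 4 * R₁ i / κ := fun i hi => by simp only [hs₁]; field_simp
  have h4₀ : ∀ i ∈ S, 4 / (s₀ i * ((2 * M : ℕ) : ℝ)) = κ / R₀ i := fun i hi => by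
    have hR : (0 : ℝ) < R₀ i := by exact_mod_cast hR₀ i hi
    rw [hs₀P i hi, div_div_eq_mul_div, div_eq_div_iff (by positivity) hR.ne']
    ring
  have h4₁ : ∀ i ∈ S, 4 / (s₁ i * L) = κ / R₁ i := fun i hi => by
    have hR : (0 : ℝ) < R₁ i := by exact_mod_cast hR₁ i hi
    rw [hs₁L i hi, div_div_eq_mul_div, div_eq_div_iff (by positivity) hR.ne']
    ring
  have hdata : ∀ i ∈ S, (∀ q, ‖G i q‖ ≤ 1) ∧ ((univ.filter fun q => G i q ≠ 0).card ≤ 64 * R₀ i * R₁ i ^ 2) ∧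
      (∀ q, ‖(fwdDiff ((fun _ : Fin 1 => (1 : ZMod (2 * M))), (0 : TorusSite 2 L)))^[2] (G i) q‖ ≤ κ ^ 2 / (R₀ i : ℝ) ^ 2) ∧
      (∀ q (d : Fin 2), ‖(fwdDiff ((0 : TorusSite 1 (2 * M)), (Pi.single d (1 : ZMod L) : TorusSite 2 L)))^[2] (G i) q‖ ≤ κ ^ 2 / (R₁ i : ℝ) ^ 2) :=
    fun i hi => productBump_bumpData (P := 2 * M) (L := L) φ hφ hK2 hφ1 hφ0 (hR₀ i hi) (hR₁ i hi) (hP' i hi) (hL' i hi)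
  have hmain := plainLine_klEffectiveAction_allStrings_of_momentumRepresentation hβ U μ K e₀ n S a κ' G ρ hker s₀ s₁ (fun _ => (1 : ℝ))
    (fun i => 64 * R₀ i * R₁ i ^ 2) (n₀ := κ ^ 3) (r := r) (by positivity) hs₀pos hs₀1 hs₁pos hs₁1 (fun _ _ => zero_le_one)
    (fun i hi => by
      rw [hs₀P i hi, hs₁L i hi]
      have hKK : κ ^ 3 * (4 * (R₀ i : ℝ) / κ) * (4 * (R₁ i : ℝ) / κ) ^ 2 = 64 * R₀ i * R₁ i ^ 2 := by
        field_simp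
        ring
      rw [hKK]; push_cast; exact le_rfl)
    (fun i hi => (hdata i hi).2.1) (fun i hi => (hdata i hi).1)
    (fun i hi q => ((hdata i hi).2.2.1 q).trans (le_of_eq (by rw [h4₀ i hi, div_pow, one_mul])))
    (fun i hi q d => ((hdata i hi).2.2.2 q d).trans (le_of_eq (by rw [h4₁ i hi, div_pow, one_mul])))
    hr s c' y
  simpa only [mul_one] using hmain

/-! ## §2 The quartic row of (X).1 at `(K, j)` from a product-bump representation -/

/-- **THE (X).1 QUARTIC ROW FROM A CANONICAL PRODUCT-BUMP REPRESENTATION**: `∃ CA > 0` (the constant of (T3)) such that, under (T3)'s binders, a representation of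
the `↑↓` quartic momentum kernel of `𝒱_j[K]` by canonical product bumps (one profile `φ ∈ C²`, `|φ| ≤ 1`, `φ = 0` off `(−1,1)`, `|φ″| ≤ κ²`, `κ ≥ 1`; radii
`4R₀ⁱ ≤ 2M`, `2R₀ⁱ+4 ≤ 2M`, `4R₁ⁱ ≤ L`, `2R₁ⁱ+4 ≤ L`), a remainder with plain line `≤ r`, and the closure
`2·klThinCountC·CA⁴·(2·(ε³·(‖κ'‖(2M·L²)²)·√(10485760·κ³)·(2M·L²)·Σ‖a_i‖ + r)) ≤ c₂·(Klam·|U|)` give `klAnisoLegKernelNormAt … K klE0 j 4 Ωe ≤ c₂·(Klam·|U|)·2^j` for every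
`Ωe` — the producer supplies profile, radii, amplitudes, normalisation and the remainder's line ONLY (no rate condition: the plain line is unweighted).
[cite: BenfattoGiulianiMastropietro2006, §2.8 (2.76)-(2.81), (2.96)-(2.98), Lemma 2.5] -/
theorem levelsUQuarticRow_klEng_of_productBumpRepresentation :
    ∃ CA : ℝ, 0 < CA ∧ ∀ (P : SplitConsts) (R : RenConsts) (c : ℝ), P.WF → R.WF2 → 0 < c → c ≤ klEngC₃6 P R → c ≤ klThinCountC₃ R →
      ∀ μ ∈ klWindowC, ∀ U : ℝ, 0 < U → U ≤ klEngU₀9 P R c → U ≤ klThinCountU₀ R → ∀ β : ℝ, klBetaMin ≤ β → β ≤ Real.exp (c / U ^ 2) →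
      ∀ K : TrigPolyC4v, FrameOK R U (nScales β) μ K → ∀ (L M : ℕ) [NeZero L] [NeZero M],
      klEngL₃ β U ≤ L → klEngM₃ β U L ≤ M → ∀ j : ℕ, 1 ≤ j → j ≤ nScales β + 1 →
        ∀ (φ : ℝ → ℝ), ContDiff ℝ 2 φ → ∀ (κ : ℝ), 1 ≤ κ → (∀ t, |iteratedDeriv 2 φ t| ≤ κ ^ 2) → (∀ t, |φ t| ≤ 1) → (∀ t, 1 ≤ |t| → φ t = 0) →
        ∀ {ι : Type} (S : Finset ι) (a : ι → ℂ) (κ' : ℂ) (R₀ R₁ : ι → ℕ), (∀ i ∈ S, 0 < R₀ i) → (∀ i ∈ S, 0 < R₁ i) →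
        (∀ i ∈ S, 4 * R₀ i ≤ 2 * M) → (∀ i ∈ S, 4 * R₁ i ≤ L) → (∀ i ∈ S, 2 * R₀ i + 4 ≤ 2 * M) → (∀ i ∈ S, 2 * R₁ i + 4 ≤ L) →
        ∀ (ρ : (Fin 4 → FreqMomentum L M) → ℂ),
        (∀ k : Fin 4 → FreqMomentum L M,
          kernel ℂ (klEffectiveAction L M β U μ K klE0 j) 4 (fun i => ((k i, (![0, 1, 0, 1] : Fin 4 → Fin 2) i), (![0, 0, 1, 1] : Fin 4 → Fin 2) i)) =
            ∑ i ∈ S, a i * (κ' * (if ((fun _ : Fin 1 => ((((k 0).1 : ℕ) : ZMod (2 * M)))), (k 0).2) + ((fun _ : Fin 1 => ((((k 1).1 : ℕ) : ZMod (2 * M)))), (k 1).2) = (((fun _ : Fin 1 => ((((k 2).1 : ℕ) : ZMod (2 * M)))), (k 2).2) : TorusSite 1 (2 * M) × TorusSite 2 L) + ((fun _ : Fin 1 => ((((k 3).1 : ℕ) : ZMod (2 * M)))), (k 3).2) then (fun Q => (fun q : TorusSite 1 (2 * M) × TorusSite 2 L => (((φ (((q.1 0).valMinAbs : ℝ) /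 R₀ i) * (φ (((q.2 0).valMinAbs : ℝ) / R₁ i) * φ (((q.2 1).valMinAbs : ℝ) / R₁ i)) : ℝ) : ℂ))) (-Q)) (((fun _ : Fin 1 => ((((k 0).1 : ℕ) : ZMod (2 * M)))), (k 0).2) + ((fun _ : Fin 1 => ((((k 1).1 : ℕ) : ZMod (2 * M)))), (k 1).2)) else 0)) + ρ k) →
        ∀ (r c₂ : ℝ),
        (∀ y : SpaceTimeIdx L M, fixedTupleL1 L M β 3
          (fun (Ω : Fin 4 → SectorLeg 1) (x : Fin 4 → SpaceTimeIdx L M) =>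
            ∑ k : Fin 4 → FreqMomentum L M, (∏ i, trivialMultiplier L M (Ω i).1.1 (k i) * hubbardPlaneWave L M β (Ω i).2 (k i) (x i)) * ρ k)
          (fun i : Fin 4 => ((((0 : Fin 1), (![0, 1, 0, 1] : Fin 4 → Fin 2) i) : Fin 1 × Fin 2), (![0, 0, 1, 1] : Fin 4 → Fin 2) i)) y ≤ r) →
        2 * klThinCountC * (CA ^ 4 * (2 * (imagTimeWeight β M ^ 3 * ((‖κ'‖ * ((((2 * M : ℕ) : ℝ) * (L : ℝ) ^ 2) ^ 2)) *
          (Real.sqrt (10485760 * κ ^ 3) * (((2 * M : ℕ) : ℝ) * (L : ℝ) ^ 2))) * ∑ i ∈ S, ‖a i‖ + r))) ≤ c₂ * (P.Klam * |U|) →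
          ∀ Ωe : Fin 4 → Option (SectorLeg (sectorCount j)),
            klAnisoLegKernelNormAt L M β U μ K klE0 j 4 Ωe ≤ c₂ * (P.Klam * |U|) * (2 : ℝ) ^ j := by
  obtain ⟨CA, hCA, h⟩ := levelsU_quarticRow_of_plainLine_klEng
  refine ⟨CA, hCA, ?_⟩
  intro P R c hP hR2 hc hc6 hcT μ hμ U hU hU9 hUT β hβmin hβc K hK L M _ _ hL3 hM3 j hj hjN φ hφ κ hκ1 hK2 hφ1 hφ0 ι S a κ' R₀ R₁ hR₀ hR₁ hP4 hL4
    hP6 hL6 ρ hker r c₂ hr hrow Ωe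
  have hβ0 : 0 < β := KLRegimeSplit.pos_of_klBetaMin_le hβmin
  have hline := plainLine_klEffectiveAction_allStrings_of_productBumpRepresentation hβ0 U μ K klE0 j φ hφ hκ1 hK2 hφ1 hφ0 S a κ' R₀ R₁ hR₀ hR₁ hP4
    hL4 hP6 hL6 ρ hker hr
  have hS0 : 0 ≤ 2 * (imagTimeWeight β M ^ 3 * ((‖κ'‖ * ((((2 * M : ℕ) : ℝ) * (L : ℝ) ^ 2) ^ 2)) *
      (Real.sqrt (10485760 * κ ^ 3) * (((2 * M : ℕ) : ℝ) * (L : ℝ) ^ 2))) * ∑ i ∈ S, ‖a i‖ + r) := by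
    obtain ⟨y⟩ : Nonempty (SpaceTimeIdx L M) := inferInstance
    refine le_trans ?_ (hline 0 0 y)
    unfold fixedTupleL1
    exact mul_nonneg (pow_nonneg (imagTimeWeight_nonneg hβ0.le M) 3) (sum_nonneg fun _ _ => norm_nonneg _)
  exact h P R c hP hR2 hc hc6 hcT μ hμ U hU hU9 hUT β hβmin hβc K hK L M hL3 hM3 j hj hjN _ c₂ hS0 (fun s c' y₀ => hline s c' y₀) hrow Ωe

end Summit.HubbardSuperconductivity.HubbardSuperconductivity.Theorems.EngineV8

end
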